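import Summits.BirchSwinnertonDyer.BirchSwinnertonDyer.Theses.EdixhovenFibreFiveSeven
import Literature.NumberTheory.EllipticCurves.IsogenyPotentiallyGoodMinimalDiscriminantProofs
import HarnessLib

/-!
# Route `EdixhovenFibreFiveSeven`, support item `PublishedManinFacts` (stmt-BirchSwinnertonDyer-22230):
# the bundle reduced BY NAME to its six still-unproved printed facts (Dokchitser–Dokchitser discharged)

Cell `pub/bsd-wall` (D-0145 line `route-BirchSwinnertonDyer-EdixhovenFibreFiveSeven`, rev 3), seat
`bsd-line-edix-p2` (prover, g7). `PublishedManinFacts` — a binder `hF` of the route's deciding theorem `closes`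
(and, verbatim, of route `TeichmullerTwistDescent`) — is the hypothesis-only conjunction of SEVEN cite-only named
facts: Edixhoven 1991 Thm. 3 in its two tree readings, Dokchitser–Dokchitser 2015 Thm. 5.1 (1), Mazur 1978 Cor. 4.1,
Abbes–Ullmo 1996 Thm. A, Česnavičius 2018 Thm. 1.2, Česnavičius–Neururer–Saha Thm. 1.2. Its third conjunct is now a
tree THEOREM (`dokchitser_padicValInt_minimalDiscriminantInt_eq_of_isogeny_of_not_dvd_degree_holds`, p602515), so
the bundle follows from the remaining six; this file records that by name (for a planner re-key of 22230 to a
six-fact bundle, or for any consumer displaying the six). HONEST STATUS: the item stays OPEN (hypothesis-only bundle,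
never asserted); the six facts are cite-only and displayed here as hypotheses; nothing is progress on BSD or on
Manin's conjecture. BSD is not proved by any of this.
-/

set_option autoImplicit false
-- the Theorems namespace of this sub repeats the summit name by design (D-0017 nested layout)
set_option linter.dupNamespace false

namespace Summit.BirchSwinnertonDyer.BirchSwinnertonDyer.Theorems

open Literature.NumberTheory.EllipticCurves Literature.NumberTheory.EllipticCurves.ModularForms

/-- **`PublishedManinFacts` (stmt-BirchSwinnertonDyer-22230) from its SIX unproved conjuncts**: Edixhoven 1991
Thm. 3 (two readings), Mazur 1978 Cor. 4.1, Abbes–Ullmo 1996 Thm. A, Česnavičius 2018 Thm. 1.2 and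
Česnavičius–Neururer–Saha Thm. 1.2 (all displayed as hypotheses), the Dokchitser–Dokchitser conjunct being the tree
theorem `dokchitser_padicValInt_minimalDiscriminantInt_eq_of_isogeny_of_not_dvd_degree_holds` (p602515).
[cite: DokchitserDokchitser2015LocalInvariants, Thm. 5.1 (1)] [cite: EdixhovenManin1991, Thm. 3]
[cite: Mazur1978, Cor. 4.1] [cite: AbbesUllmo1996, Thm. A] [cite: Cesnavicius2018, Thm. 1.2]
[cite: CesnaviciusNeururerSaha2023, Thm. 1.2] -/
theorem publishedManinFacts_of_six
    (e1 : edixhoven_not_dvd_maninConstant_of_not_potentiallyGoodOrdinary)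
    (e2 : edixhoven_not_dvd_maninConstant_of_kodairaSymbol_ne)
    (mz : mazur_not_dvd_maninConstant_of_odd)
    (au : abbesUllmo_not_dvd_maninConstant_of_not_dvd_level)
    (c2 : cesnavicius_not_two_dvd_maninConstant_of_two_dvd_level)
    (cns : cesnaviciusNeururerSaha_padicVal_maninConstant_le_modularDegree) :
    Summit.BirchSwinnertonDyer.BirchSwinnertonDyer.Theses.EdixhovenFibreFiveSeven.PublishedManinFacts := by
  unfold Summit.BirchSwinnertonDyer.BirchSwinnertonDyer.Theses.EdixhovenFibreFiveSeven.PublishedManinFacts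
  exact ⟨e1, e2, dokchitser_padicValInt_minimalDiscriminantInt_eq_of_isogeny_of_not_dvd_degree_holds, mz, au,
    c2, cns⟩

/-- Conversely the bundle hands back the six (projection; for the record the two sides are equivalent).
[cite: EdixhovenManin1991, Thm. 3] -/
theorem publishedManinFacts_iff_six :
    Summit.BirchSwinnertonDyer.BirchSwinnertonDyer.Theses.EdixhovenFibreFiveSeven.PublishedManinFacts ↔
      (edixhoven_not_dvd_maninConstant_of_not_potentiallyGoodOrdinary ∧
        edixhoven_not_dvd_maninConstant_of_kodairaSymbol_ne ∧
        mazur_not_dvd_maninConstant_of_odd ∧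
        abbesUllmo_not_dvd_maninConstant_of_not_dvd_level ∧
        cesnavicius_not_two_dvd_maninConstant_of_two_dvd_level ∧
        cesnaviciusNeururerSaha_padicVal_maninConstant_le_modularDegree) :=
  ⟨fun ⟨e1, e2, _, mz, au, c2, cns⟩ => ⟨e1, e2, mz, au, c2, cns⟩,
    fun ⟨e1, e2, mz, au, c2, cns⟩ => publishedManinFacts_of_six e1 e2 mz au c2 cns⟩

end Summit.BirchSwinnertonDyer.BirchSwinnertonDyer.Theorems
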